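import Summits.BirchSwinnertonDyer.Rank1Residual.GaloisImage.VisibleIndexBudgetPilot
import HarnessLib

/-!
# T-IDX27-REC (FILE 7): `Ш(E)[3] ≠ 0` for the PASS-rank3 rows `287775i1 ~ 287775a1`, `293184cj1 ~ 293184c1`, `337896u1 ~ 37544c1` by the COUNT road with
# kernel index certificates `27 ≤ [E′(ℚ):3E′(ℚ)]` (team n1011, seat p17 lineage, row T-IDX27-REC; D15's shape)

HONEST FRAMING (cell `b2b-bsdres`, run/shared/lean/b2b/bsd-rank1-residual/, verbatim in every
file): the goal of the cell is to DELETE the COMBINATION-SHAPED residual classes of the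
Birch–Swinnerton-Dyer formula for ALL analytic-rank `≤ 1` elliptic curves over `ℚ` — "full BSD
formula for every rank `≤ 1` curve in class `C`" assembled STRICTLY from published theorems — so
that the rank-`≤ 1` remainder becomes exactly the CONSTRUCTION-SHAPED classes, which are TYPED
(missing-input `Prop`s), NOT attempted. This is not "finishing BSD". Team n1011 (N10/N11): research
route; this file is a set of per-pair KERNEL INSTANCES (EVIDENCE level: each record proves
`Ш(E)[3] ≠ 0` for ONE pair GIVEN `θ`, finiteness and coprimality — it closes nothing by itself; the
BSDp record with its EVIDENCE binders is the records lanes'); nothing is booked; no mark / label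
moved; X4 stays CONSTRUCTION-SHAPED. THEOREMS only; no definition, no named fact, no `sorry`.

## What

For each of r1's PASS-rank3 rows `E ~ E′` below (`route1/g29_cvis_pairs.tsv`: `E` an X4 curve with
`r_an = 0`, `E′` a `3`-congruent partner of Mordell–Weil rank `3`; inputs
`HOME/b2b-bsdres-n1011-p17/gen9/census/T-IDX27-PASSRANK3-INPUTS.md`, all 27/27 specified; the two
pilot rows are FILE D15 `GaloisImage/VisibleIndexBudgetPilot.lean`), token-for-token the pilot's recipe:
* ONE index instance `twentyseven_le_index_<E′>` — `27 ≤ [E′(ℚ):3E′(ℚ)]` by FILE D11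
  `twentyseven_le_index_range_zsmul_three_of_checks` from three Cremona generators, the ten compound
  points and thirteen NO-prime certificates `threeNonDivCheckAt … = true` (`decide +kernel`), the
  thirteen points checked ON the curve by `norm_num`;
* ONE record `exists_sha_three_torsion_<E>` over FILE D13
  `exists_sha_three_torsion_of_congr_of_index_of_primeList`: `L ⊇ primes(Δ_E Δ_E′) ∪ {3}` by x11c's
  factorisation certificates `X11b.forall_mem_of_natAbs_eq_prod_pow`, `#E′(ℚ_q)[3] = 1` at the free
  places `q ≠ 3` by T-LOC3L FILE L5 certificates (`threeTorsionCheckAt … = some 0`), the costly place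
  `3` by FILE D14 `natCard_ker_nsmul_three_adicCompletion_le_three_at3` (`μ₃(ℚ₃) = 1`, Weil pairing —
  no certificate, `t = 3`), budget `3 · 3 = 9 < 27`.
Displayed (NOT discharged): `θ : E′[3] ≅ E[3]` with `hθ`, `Finite E(ℚ)`, `(#E(ℚ), 3) = 1` — the
binder list is exactly the pilot's `(W W′ hW hW′ θ hθ hfin hcop)`.

Rows in this file: `287775i1 ~ 287775a1` (`E₀ = [1, -1, 0, -9867, -374584]`, `F₀ = [0, 0, 1, 45, 506]`, `L = [3, 5, 1279]`); `293184cj1 ~ 293184c1` (`E₀ = [0, 0, 0, -14981484, 22107226192]`, `F₀ = [0, 0, 0, -252, 1360]`, `L = [2, 3, 509]`); `337896u1 ~ 37544c1` (`E₀ = [0, 0, 0, 102885, 84187366]`, `F₀ = [0, 1, 0, -177, 1171]`, `L = [2, 3, 13, 19]`).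

References: [CremonaMazur2000] §3; [AgasheStein2002] Thm. 3.1; [Cremona2006] (labels).
-/

set_option autoImplicit false

open WeierstrassCurve NumberField IsDedekindDomain Rat.HeightOneSpectrum Field
  Literature.NumberTheory.EllipticCurves Literature.NumberTheory.GaloisRepresentations
open Summit.BirchSwinnertonDyer.Rank1Residual.GaloisImage.LocalTorsion3At
  (threeTorsionCheckAt natCard_ker_nsmul_three_adicCompletion_eq_of_checkAt)
open Summit.BirchSwinnertonDyer.Rank1Residual

namespace Summit.BirchSwinnertonDyer.Rank1Residual.GaloisImage.DivisionDecider

/-- **Index instance `287775a1`** (`[0, 0, 1, 45, 506]`, Cremona rank 3; r1 PASS-rank3 row `287775i1 ~ 287775a1`):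
generators `(0, 22)`, `(15, 67)`, `(6, 31)`, the ten compound points `P₁±P₂, P₁±P₃, P₂±P₃, (P₁+P₂)±P₃,
(P₁−P₂)±P₃` and thirteen NO-primes `[3, 11, 3, 3, 3, 11, 3, 3, 3, 11, 3, 29, 3]` (census `gen9/census/idx27_certs.json`); the
thirteen points checked ON the curve by `norm_num` (`nonsingular_of_eq`), chords and certificates by
`decide +kernel` after `clear d`. [folklore] -/
theorem twentyseven_le_index_287775a1 (W' : WeierstrassCurve ℚ) [W'.IsElliptic]
    (hW' : W' = ⟨0, 0, 1, 45, 506⟩) (d : DecidableEq ℚ) :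
    27 ≤ (letI : DecidableEq ℚ := d
      (zsmulAddGroupHom ((3 : ℕ) : ℤ) : W'.toAffine.Point →+ W'.toAffine.Point).range.index) :=
  twentyseven_le_index_range_zsmul_three_of_checks 0 0 1 45 506 W' hW'
    (x₁ := 0) (y₁ := 22) (x₂ := 15) (y₂ := 67)
    (x₃ := 6) (y₃ := 31)
    (u₁ := (-6)) (v₁ := (-5))
    (u₂ := 21) (v₂ := 103)
    (u₃ := (-15 / 4)) (v₃ := (-139 / 8))
    (u₄ := 75) (v₄ := 652)
    (u₅ := (-5)) (v₅ := 12)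
    (u₆ := 100) (v₆ := (-1003))
    (u₇ := 9) (v₇ := (-41))
    (u₈ := (81 / 16)) (v₈ := (1849 / 64))
    (u₉ := (-99 / 25)) (v₉ := (1976 / 125))
    (u₁₀ := 54) (v₁₀ := (-401))
    (nonsingular_of_eq W' (by clear d; subst hW'; norm_num))
    (nonsingular_of_eq W' (by clear d; subst hW'; norm_num))
    (nonsingular_of_eq W' (by clear d; subst hW'; norm_num))
    (nonsingular_of_eq W' (by clear d; subst hW'; norm_num))
    (nonsingular_of_eq W' (by clear d; subst hW'; norm_num))
    (nonsingular_of_eq W' (by clear d; subst hW'; norm_num))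
    (nonsingular_of_eq W' (by clear d; subst hW'; norm_num))
    (nonsingular_of_eq W' (by clear d; subst hW'; norm_num))
    (nonsingular_of_eq W' (by clear d; subst hW'; norm_num))
    (nonsingular_of_eq W' (by clear d; subst hW'; norm_num))
    (nonsingular_of_eq W' (by clear d; subst hW'; norm_num))
    (nonsingular_of_eq W' (by clear d; subst hW'; norm_num))
    (nonsingular_of_eq W' (by clear d; subst hW'; norm_num))
    (by norm_num) (by norm_num) (by norm_num) (by norm_num) (by norm_num)
    (by clear d; subst hW'; decide +kernel) (by clear d; subst hW'; decide +kernel)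
    (by clear d; subst hW'; decide +kernel) (by clear d; subst hW'; decide +kernel)
    (by clear d; subst hW'; decide +kernel) (by clear d; subst hW'; decide +kernel)
    (by clear d; subst hW'; decide +kernel) (by clear d; subst hW'; decide +kernel)
    (by clear d; subst hW'; decide +kernel) (by clear d; subst hW'; decide +kernel)
    (by clear d; subst hW'; decide +kernel) (by clear d; subst hW'; decide +kernel)
    (by clear d; subst hW'; decide +kernel) (by clear d; subst hW'; decide +kernel)
    (by clear d; subst hW'; decide +kernel) (by clear d; subst hW'; decide +kernel)
    (by clear d; subst hW'; decide +kernel) (by clear d; subst hW'; decide +kernel)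
    (by clear d; subst hW'; decide +kernel) (by clear d; subst hW'; decide +kernel)
    (ℓ₁ := 3) (ℓ₂ := 11) (ℓ₃ := 3) (ℓ₄ := 3) (ℓ₅ := 3) (ℓ₆ := 11) (ℓ₇ := 3) (ℓ₈ := 3) (ℓ₉ := 3) (ℓ₁₀ := 11) (ℓ₁₁ := 3) (ℓ₁₂ := 29) (ℓ₁₃ := 3)
    (hℓ₁ := ⟨Nat.prime_three⟩) (hℓ₂ := ⟨by norm_num⟩) (hℓ₃ := ⟨Nat.prime_three⟩)
    (hℓ₄ := ⟨Nat.prime_three⟩) (hℓ₅ := ⟨Nat.prime_three⟩) (hℓ₆ := ⟨by norm_num⟩)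
    (hℓ₇ := ⟨Nat.prime_three⟩) (hℓ₈ := ⟨Nat.prime_three⟩) (hℓ₉ := ⟨Nat.prime_three⟩)
    (hℓ₁₀ := ⟨by norm_num⟩) (hℓ₁₁ := ⟨Nat.prime_three⟩) (hℓ₁₂ := ⟨by norm_num⟩)
    (hℓ₁₃ := ⟨Nat.prime_three⟩)
    (k₁ := 2) (k₂ := 1) (k₃ := 2) (k₄ := 2) (k₅ := 2) (k₆ := 1) (k₇ := 2) (k₈ := 1) (k₉ := 1) (k₁₀ := 1) (k₁₁ := 2) (k₁₂ := 1) (k₁₃ := 2)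
    (by decide +kernel) (by decide +kernel) (by decide +kernel) (by decide +kernel)
    (by decide +kernel) (by decide +kernel) (by decide +kernel) (by decide +kernel)
    (by decide +kernel) (by decide +kernel) (by decide +kernel) (by decide +kernel)
    (by decide +kernel) d

/-- **T-IDX27-REC `287775i1 ~ 287775a1` (PASS-rank3, `L = [3, 5, 1279]`): `Ш(E/ℚ)[3] ≠ 0` in the `hvis` currency** from
`θ`, `Finite E(ℚ)`, coprimality — everything else decided in the kernel: factorisation certificates
(`|Δ(E₀)| = 3^3·5^9·1279^1`, `|Δ(F₀)| = 3^6·5^3·1279^1`), `#E′(ℚ_q)[3] = 1` at `q ∈ [5, 1279]` by T-LOC3L L5 certificates, the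
place `3` by D14 (`μ₃(ℚ₃) = 1`, `t = 3`), the index certificate `twentyseven_le_index_287775a1`, budget `3·3 < 27`.
[cite: CremonaMazur2000, §3 pp. 19–22] [cite: Cremona2006, Table 1 (Cremona labels 287775i1, 287775a1)] -/
theorem exists_sha_three_torsion_287775i1 (W W' : WeierstrassCurve ℚ) [W.IsElliptic] [W'.IsElliptic]
    (hW : W = ⟨1, -1, 0, -9867, -374584⟩) (hW' : W' = ⟨0, 0, 1, 45, 506⟩)
    (θ : geomTorsion W' ((3 : ℕ) : ℤ) ≃+ geomTorsion W ((3 : ℕ) : ℤ))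
    (hθ : ∀ (σ : Field.absoluteGaloisGroup ℚ) (P : geomTorsion W' ((3 : ℕ) : ℤ)),
      θ (σ • P) = σ • θ P)
    (hfin : Finite W.toAffine.Point) (hcop : (Nat.card W.toAffine.Point).Coprime 3) :
    ∃ c : W.sha, c ≠ 0 ∧ (3 : ℕ) • c = 0 := by
  haveI : Fact (Nat.Prime 5) := ⟨by norm_num⟩
  haveI : Fact (Nat.Prime 1279) := ⟨by norm_num⟩
  have hidx := twentyseven_le_index_287775a1 W' hW' (fun a b => Classical.propDecidable (a = b))
  refine exists_sha_three_torsion_of_congr_of_index_of_primeList W W' θ hθ hfin hcop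
    (E₀ := ⟨1, -1, 0, -9867, -374584⟩) (F₀ := ⟨0, 0, 1, 45, 506⟩)
    (by subst hW; ext <;> simp [WeierstrassCurve.map])
    (by subst hW'; ext <;> simp [WeierstrassCurve.map])
    [3, 5, 1279] (by decide)
    (X11b.forall_mem_of_natAbs_eq_prod_pow [3, 5, 1279] [3, 9, 1]
      (by intro q hq; simp only [List.mem_cons, List.mem_nil_iff, or_false] at hq; rcases hq with rfl | rfl | rfl <;> norm_num)
      (by decide +kernel))
    (X11b.forall_mem_of_natAbs_eq_prod_pow [3, 5, 1279] [6, 3, 1]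
      (by intro q hq; simp only [List.mem_cons, List.mem_nil_iff, or_false] at hq; rcases hq with rfl | rfl | rfl <;> norm_num)
      (by decide +kernel))
    Nat.prime_three (by decide) (t := 3)
    (fun v hv => natCard_ker_nsmul_three_adicCompletion_le_three_at3 W' hv)
    (fun v hvL hv3 => ?_) (m := 27) (by norm_num) hidx
  have hcases : (primesEquiv v : ℕ) = 5 ∨ (primesEquiv v : ℕ) = 1279 := by
    simp only [List.mem_cons, List.mem_nil_iff, or_false] at hvL
    omega
  rcases hcases with h5 | h1279
  · exact (natCard_ker_nsmul_three_adicCompletion_eq_of_checkAt 5 0 0 1 45 506 (by norm_num)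
      (by decide) (k := 1) (S := 0) (cert := []) (by decide +kernel) W' hW' h5).trans
      (by norm_num)
  · exact (natCard_ker_nsmul_three_adicCompletion_eq_of_checkAt 1279 0 0 1 45 506 (by norm_num)
      (by decide) (k := 1) (S := 0) (cert := [((850 : ℤ), 0, 1, 0)]) (by decide +kernel) W' hW' h1279).trans
      (by norm_num)

/-- **Index instance `293184c1`** (`[0, 0, 0, -252, 1360]`, Cremona rank 3; r1 PASS-rank3 row `293184cj1 ~ 293184c1`):
generators `(14, 24)`, `(6, 8)`, `(38, 216)`, the ten compound points `P₁±P₂, P₁±P₃, P₂±P₃, (P₁+P₂)±P₃,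
(P₁−P₂)±P₃` and thirteen NO-primes `[3, 3, 7, 3, 3, 3, 3, 3, 3, 7, 7, 3, 3]` (census `gen9/census/idx27_certs.json`); the
thirteen points checked ON the curve by `norm_num` (`nonsingular_of_eq`), chords and certificates by
`decide +kernel` after `clear d`. [folklore] -/
theorem twentyseven_le_index_293184c1 (W' : WeierstrassCurve ℚ) [W'.IsElliptic]
    (hW' : W' = ⟨0, 0, 0, -252, 1360⟩) (d : DecidableEq ℚ) :
    27 ≤ (letI : DecidableEq ℚ := d
      (zsmulAddGroupHom ((3 : ℕ) : ℤ) : W'.toAffine.Point →+ W'.toAffine.Point).range.index) :=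
  twentyseven_le_index_range_zsmul_three_of_checks 0 0 0 (-252) 1360 W' hW'
    (x₁ := 14) (y₁ := 24) (x₂ := 6) (y₂ := 8)
    (x₃ := 38) (y₃ := 216)
    (u₁ := (-16)) (v₁ := 36)
    (u₂ := (-4)) (v₂ := 48)
    (u₃ := 12) (v₃ := (-8))
    (u₄ := 48) (v₄ := 316)
    (u₅ := (-7 / 4)) (v₅ := (339 / 8))
    (u₆ := 5) (v₆ := (-15))
    (u₇ := (-98 / 9)) (v₇ := (-1432 / 27))
    (u₈ := (-2 / 9)) (v₈ := (1016 / 27))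
    (u₉ := (-18)) (v₉ := 8)
    (u₁₀ := (270 / 49)) (v₁₀ := (4040 / 343))
    (nonsingular_of_eq W' (by clear d; subst hW'; norm_num))
    (nonsingular_of_eq W' (by clear d; subst hW'; norm_num))
    (nonsingular_of_eq W' (by clear d; subst hW'; norm_num))
    (nonsingular_of_eq W' (by clear d; subst hW'; norm_num))
    (nonsingular_of_eq W' (by clear d; subst hW'; norm_num))
    (nonsingular_of_eq W' (by clear d; subst hW'; norm_num))
    (nonsingular_of_eq W' (by clear d; subst hW'; norm_num))
    (nonsingular_of_eq W' (by clear d; subst hW'; norm_num))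
    (nonsingular_of_eq W' (by clear d; subst hW'; norm_num))
    (nonsingular_of_eq W' (by clear d; subst hW'; norm_num))
    (nonsingular_of_eq W' (by clear d; subst hW'; norm_num))
    (nonsingular_of_eq W' (by clear d; subst hW'; norm_num))
    (nonsingular_of_eq W' (by clear d; subst hW'; norm_num))
    (by norm_num) (by norm_num) (by norm_num) (by norm_num) (by norm_num)
    (by clear d; subst hW'; decide +kernel) (by clear d; subst hW'; decide +kernel)
    (by clear d; subst hW'; decide +kernel) (by clear d; subst hW'; decide +kernel)
    (by clear d; subst hW'; decide +kernel) (by clear d; subst hW'; decide +kernel)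
    (by clear d; subst hW'; decide +kernel) (by clear d; subst hW'; decide +kernel)
    (by clear d; subst hW'; decide +kernel) (by clear d; subst hW'; decide +kernel)
    (by clear d; subst hW'; decide +kernel) (by clear d; subst hW'; decide +kernel)
    (by clear d; subst hW'; decide +kernel) (by clear d; subst hW'; decide +kernel)
    (by clear d; subst hW'; decide +kernel) (by clear d; subst hW'; decide +kernel)
    (by clear d; subst hW'; decide +kernel) (by clear d; subst hW'; decide +kernel)
    (by clear d; subst hW'; decide +kernel) (by clear d; subst hW'; decide +kernel)
    (ℓ₁ := 3) (ℓ₂ := 3) (ℓ₃ := 7) (ℓ₄ := 3) (ℓ₅ := 3) (ℓ₆ := 3) (ℓ₇ := 3) (ℓ₈ := 3) (ℓ₉ := 3) (ℓ₁₀ := 7) (ℓ₁₁ := 7) (ℓ₁₂ := 3) (ℓ₁₃ := 3)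
    (hℓ₁ := ⟨Nat.prime_three⟩) (hℓ₂ := ⟨Nat.prime_three⟩) (hℓ₃ := ⟨by norm_num⟩)
    (hℓ₄ := ⟨Nat.prime_three⟩) (hℓ₅ := ⟨Nat.prime_three⟩) (hℓ₆ := ⟨Nat.prime_three⟩)
    (hℓ₇ := ⟨Nat.prime_three⟩) (hℓ₈ := ⟨Nat.prime_three⟩) (hℓ₉ := ⟨Nat.prime_three⟩)
    (hℓ₁₀ := ⟨by norm_num⟩) (hℓ₁₁ := ⟨by norm_num⟩) (hℓ₁₂ := ⟨Nat.prime_three⟩)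
    (hℓ₁₃ := ⟨Nat.prime_three⟩)
    (k₁ := 1) (k₂ := 1) (k₃ := 1) (k₄ := 2) (k₅ := 1) (k₆ := 1) (k₇ := 1) (k₈ := 1) (k₉ := 1) (k₁₀ := 1) (k₁₁ := 1) (k₁₂ := 1) (k₁₃ := 1)
    (by decide +kernel) (by decide +kernel) (by decide +kernel) (by decide +kernel)
    (by decide +kernel) (by decide +kernel) (by decide +kernel) (by decide +kernel)
    (by decide +kernel) (by decide +kernel) (by decide +kernel) (by decide +kernel)
    (by decide +kernel) d

/-- **T-IDX27-REC `293184cj1 ~ 293184c1` (PASS-rank3, `L = [2, 3, 509]`): `Ш(E/ℚ)[3] ≠ 0` in the `hvis` currency** from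
`θ`, `Finite E(ℚ)`, coprimality — everything else decided in the kernel: factorisation certificates
(`|Δ(E₀)| = 2^20·3^27·509^1`, `|Δ(F₀)| = 2^14·3^3·509^1`), `#E′(ℚ_q)[3] = 1` at `q ∈ [2, 509]` by T-LOC3L L5 certificates, the
place `3` by D14 (`μ₃(ℚ₃) = 1`, `t = 3`), the index certificate `twentyseven_le_index_293184c1`, budget `3·3 < 27`.
[cite: CremonaMazur2000, §3 pp. 19–22] [cite: Cremona2006, Table 1 (Cremona labels 293184cj1, 293184c1)] -/
theorem exists_sha_three_torsion_293184cj1 (W W' : WeierstrassCurve ℚ) [W.IsElliptic] [W'.IsElliptic]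
    (hW : W = ⟨0, 0, 0, -14981484, 22107226192⟩) (hW' : W' = ⟨0, 0, 0, -252, 1360⟩)
    (θ : geomTorsion W' ((3 : ℕ) : ℤ) ≃+ geomTorsion W ((3 : ℕ) : ℤ))
    (hθ : ∀ (σ : Field.absoluteGaloisGroup ℚ) (P : geomTorsion W' ((3 : ℕ) : ℤ)),
      θ (σ • P) = σ • θ P)
    (hfin : Finite W.toAffine.Point) (hcop : (Nat.card W.toAffine.Point).Coprime 3) :
    ∃ c : W.sha, c ≠ 0 ∧ (3 : ℕ) • c = 0 := by
  haveI : Fact (Nat.Prime 2) := ⟨Nat.prime_two⟩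
  haveI : Fact (Nat.Prime 509) := ⟨by norm_num⟩
  have hidx := twentyseven_le_index_293184c1 W' hW' (fun a b => Classical.propDecidable (a = b))
  refine exists_sha_three_torsion_of_congr_of_index_of_primeList W W' θ hθ hfin hcop
    (E₀ := ⟨0, 0, 0, -14981484, 22107226192⟩) (F₀ := ⟨0, 0, 0, -252, 1360⟩)
    (by subst hW; ext <;> simp [WeierstrassCurve.map])
    (by subst hW'; ext <;> simp [WeierstrassCurve.map])
    [2, 3, 509] (by decide)
    (X11b.forall_mem_of_natAbs_eq_prod_pow [2, 3, 509] [20, 27, 1]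
      (by intro q hq; simp only [List.mem_cons, List.mem_nil_iff, or_false] at hq; rcases hq with rfl | rfl | rfl <;> norm_num)
      (by decide +kernel))
    (X11b.forall_mem_of_natAbs_eq_prod_pow [2, 3, 509] [14, 3, 1]
      (by intro q hq; simp only [List.mem_cons, List.mem_nil_iff, or_false] at hq; rcases hq with rfl | rfl | rfl <;> norm_num)
      (by decide +kernel))
    Nat.prime_three (by decide) (t := 3)
    (fun v hv => natCard_ker_nsmul_three_adicCompletion_le_three_at3 W' hv)
    (fun v hvL hv3 => ?_) (m := 27) (by norm_num) hidx
  have hcases : (primesEquiv v : ℕ) = 2 ∨ (primesEquiv v : ℕ) = 509 := by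
    simp only [List.mem_cons, List.mem_nil_iff, or_false] at hvL
    omega
  rcases hcases with h2 | h509
  · exact (natCard_ker_nsmul_three_adicCompletion_eq_of_checkAt 2 0 0 0 (-252) 1360 (by norm_num)
      (by decide) (k := 8) (S := 0) (cert := [((44066 : ℤ), 7, 17, 7)]) (by decide +kernel) W' hW' h2).trans
      (by norm_num)
  · exact (natCard_ker_nsmul_three_adicCompletion_eq_of_checkAt 509 0 0 0 (-252) 1360 (by norm_num)
      (by decide) (k := 1) (S := 0) (cert := [((412 : ℤ), 0, 1, 0)]) (by decide +kernel) W' hW' h509).trans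
      (by norm_num)

/-- **Index instance `37544c1`** (`[0, 1, 0, -177, 1171]`, Cremona rank 3; r1 PASS-rank3 row `337896u1 ~ 37544c1`):
generators `(11, 26)`, `(63, 494)`, `(-13, 38)`, the ten compound points `P₁±P₂, P₁±P₃, P₂±P₃, (P₁+P₂)±P₃,
(P₁−P₂)±P₃` and thirteen NO-primes `[3, 3, 3, 3, 3, 3, 5, 3, 3, 5, 3, 3, 3]` (census `gen9/census/idx27_certs.json`); the
thirteen points checked ON the curve by `norm_num` (`nonsingular_of_eq`), chords and certificates by
`decide +kernel` after `clear d`. [folklore] -/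
theorem twentyseven_le_index_37544c1 (W' : WeierstrassCurve ℚ) [W'.IsElliptic]
    (hW' : W' = ⟨0, 1, 0, -177, 1171⟩) (d : DecidableEq ℚ) :
    27 ≤ (letI : DecidableEq ℚ := d
      (zsmulAddGroupHom ((3 : ℕ) : ℤ) : W'.toAffine.Point →+ W'.toAffine.Point).range.index) :=
  twentyseven_le_index_range_zsmul_three_of_checks 0 1 0 (-177) 1171 W' hW'
    (x₁ := 11) (y₁ := 26) (x₂ := 63) (y₂ := 494)
    (x₃ := (-13)) (y₃ := 38)
    (u₁ := 6) (v₁ := 19)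
    (u₂ := 25) (v₂ := 114)
    (u₃ := (5 / 4)) (v₃ := (-247 / 8))
    (u₄ := (73 / 9)) (v₄ := (-494 / 27))
    (u₅ := (-15)) (v₅ := (-26))
    (u₆ := (-2)) (v₆ := (-39))
    (u₇ := 7) (v₇ := (-18))
    (u₈ := 15) (v₈ := (-46))
    (u₉ := (-9)) (v₉ := (-46))
    (u₁₀ := 3) (v₁₀ := (-26))
    (nonsingular_of_eq W' (by clear d; subst hW'; norm_num))
    (nonsingular_of_eq W' (by clear d; subst hW'; norm_num))
    (nonsingular_of_eq W' (by clear d; subst hW'; norm_num))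
    (nonsingular_of_eq W' (by clear d; subst hW'; norm_num))
    (nonsingular_of_eq W' (by clear d; subst hW'; norm_num))
    (nonsingular_of_eq W' (by clear d; subst hW'; norm_num))
    (nonsingular_of_eq W' (by clear d; subst hW'; norm_num))
    (nonsingular_of_eq W' (by clear d; subst hW'; norm_num))
    (nonsingular_of_eq W' (by clear d; subst hW'; norm_num))
    (nonsingular_of_eq W' (by clear d; subst hW'; norm_num))
    (nonsingular_of_eq W' (by clear d; subst hW'; norm_num))
    (nonsingular_of_eq W' (by clear d; subst hW'; norm_num))
    (nonsingular_of_eq W' (by clear d; subst hW'; norm_num))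
    (by norm_num) (by norm_num) (by norm_num) (by norm_num) (by norm_num)
    (by clear d; subst hW'; decide +kernel) (by clear d; subst hW'; decide +kernel)
    (by clear d; subst hW'; decide +kernel) (by clear d; subst hW'; decide +kernel)
    (by clear d; subst hW'; decide +kernel) (by clear d; subst hW'; decide +kernel)
    (by clear d; subst hW'; decide +kernel) (by clear d; subst hW'; decide +kernel)
    (by clear d; subst hW'; decide +kernel) (by clear d; subst hW'; decide +kernel)
    (by clear d; subst hW'; decide +kernel) (by clear d; subst hW'; decide +kernel)
    (by clear d; subst hW'; decide +kernel) (by clear d; subst hW'; decide +kernel)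
    (by clear d; subst hW'; decide +kernel) (by clear d; subst hW'; decide +kernel)
    (by clear d; subst hW'; decide +kernel) (by clear d; subst hW'; decide +kernel)
    (by clear d; subst hW'; decide +kernel) (by clear d; subst hW'; decide +kernel)
    (ℓ₁ := 3) (ℓ₂ := 3) (ℓ₃ := 3) (ℓ₄ := 3) (ℓ₅ := 3) (ℓ₆ := 3) (ℓ₇ := 5) (ℓ₈ := 3) (ℓ₉ := 3) (ℓ₁₀ := 5) (ℓ₁₁ := 3) (ℓ₁₂ := 3) (ℓ₁₃ := 3)
    (hℓ₁ := ⟨Nat.prime_three⟩) (hℓ₂ := ⟨Nat.prime_three⟩) (hℓ₃ := ⟨Nat.prime_three⟩)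
    (hℓ₄ := ⟨Nat.prime_three⟩) (hℓ₅ := ⟨Nat.prime_three⟩) (hℓ₆ := ⟨Nat.prime_three⟩)
    (hℓ₇ := ⟨by norm_num⟩) (hℓ₈ := ⟨Nat.prime_three⟩) (hℓ₉ := ⟨Nat.prime_three⟩)
    (hℓ₁₀ := ⟨by norm_num⟩) (hℓ₁₁ := ⟨Nat.prime_three⟩) (hℓ₁₂ := ⟨Nat.prime_three⟩)
    (hℓ₁₃ := ⟨Nat.prime_three⟩)
    (k₁ := 1) (k₂ := 1) (k₃ := 1) (k₄ := 1) (k₅ := 1) (k₆ := 1) (k₇ := 1) (k₈ := 1) (k₉ := 1) (k₁₀ := 1) (k₁₁ := 1) (k₁₂ := 1) (k₁₃ := 1)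
    (by decide +kernel) (by decide +kernel) (by decide +kernel) (by decide +kernel)
    (by decide +kernel) (by decide +kernel) (by decide +kernel) (by decide +kernel)
    (by decide +kernel) (by decide +kernel) (by decide +kernel) (by decide +kernel)
    (by decide +kernel) d

/-- **T-IDX27-REC `337896u1 ~ 37544c1` (PASS-rank3, `L = [2, 3, 13, 19]`): `Ш(E/ℚ)[3] ≠ 0` in the `hvis` currency** from
`θ`, `Finite E(ℚ)`, coprimality — everything else decided in the kernel: factorisation certificates
(`|Δ(E₀)| = 2^10·3^6·13^1·19^9`, `|Δ(F₀)| = 2^8·3^0·13^2·19^3`), `#E′(ℚ_q)[3] = 1` at `q ∈ [2, 13, 19]` by T-LOC3L L5 certificates, the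
place `3` by D14 (`μ₃(ℚ₃) = 1`, `t = 3`), the index certificate `twentyseven_le_index_37544c1`, budget `3·3 < 27`.
[cite: CremonaMazur2000, §3 pp. 19–22] [cite: Cremona2006, Table 1 (Cremona labels 337896u1, 37544c1)] -/
theorem exists_sha_three_torsion_337896u1 (W W' : WeierstrassCurve ℚ) [W.IsElliptic] [W'.IsElliptic]
    (hW : W = ⟨0, 0, 0, 102885, 84187366⟩) (hW' : W' = ⟨0, 1, 0, -177, 1171⟩)
    (θ : geomTorsion W' ((3 : ℕ) : ℤ) ≃+ geomTorsion W ((3 : ℕ) : ℤ))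
    (hθ : ∀ (σ : Field.absoluteGaloisGroup ℚ) (P : geomTorsion W' ((3 : ℕ) : ℤ)),
      θ (σ • P) = σ • θ P)
    (hfin : Finite W.toAffine.Point) (hcop : (Nat.card W.toAffine.Point).Coprime 3) :
    ∃ c : W.sha, c ≠ 0 ∧ (3 : ℕ) • c = 0 := by
  haveI : Fact (Nat.Prime 2) := ⟨Nat.prime_two⟩
  haveI : Fact (Nat.Prime 13) := ⟨by norm_num⟩
  haveI : Fact (Nat.Prime 19) := ⟨by norm_num⟩
  have hidx := twentyseven_le_index_37544c1 W' hW' (fun a b => Classical.propDecidable (a = b))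
  refine exists_sha_three_torsion_of_congr_of_index_of_primeList W W' θ hθ hfin hcop
    (E₀ := ⟨0, 0, 0, 102885, 84187366⟩) (F₀ := ⟨0, 1, 0, -177, 1171⟩)
    (by subst hW; ext <;> simp [WeierstrassCurve.map])
    (by subst hW'; ext <;> simp [WeierstrassCurve.map])
    [2, 3, 13, 19] (by decide)
    (X11b.forall_mem_of_natAbs_eq_prod_pow [2, 3, 13, 19] [10, 6, 1, 9]
      (by intro q hq; simp only [List.mem_cons, List.mem_nil_iff, or_false] at hq; rcases hq with rfl | rfl | rfl | rfl <;> norm_num)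
      (by decide +kernel))
    (X11b.forall_mem_of_natAbs_eq_prod_pow [2, 3, 13, 19] [8, 0, 2, 3]
      (by intro q hq; simp only [List.mem_cons, List.mem_nil_iff, or_false] at hq; rcases hq with rfl | rfl | rfl | rfl <;> norm_num)
      (by decide +kernel))
    Nat.prime_three (by decide) (t := 3)
    (fun v hv => natCard_ker_nsmul_three_adicCompletion_le_three_at3 W' hv)
    (fun v hvL hv3 => ?_) (m := 27) (by norm_num) hidx
  have hcases : (primesEquiv v : ℕ) = 2 ∨ (primesEquiv v : ℕ) = 13 ∨ (primesEquiv v : ℕ) = 19 := by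
    simp only [List.mem_cons, List.mem_nil_iff, or_false] at hvL
    omega
  rcases hcases with h2 | h13 | h19
  · exact (natCard_ker_nsmul_three_adicCompletion_eq_of_checkAt 2 0 1 0 (-177) 1171 (by norm_num)
      (by decide) (k := 2) (S := 0) (cert := []) (by decide +kernel) W' hW' h2).trans
      (by norm_num)
  · exact (natCard_ker_nsmul_three_adicCompletion_eq_of_checkAt 13 0 1 0 (-177) 1171 (by norm_num)
      (by decide) (k := 1) (S := 0) (cert := [((9 : ℤ), 0, 1, 0)]) (by decide +kernel) W' hW' h13).trans
      (by norm_num)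
  · exact (natCard_ker_nsmul_three_adicCompletion_eq_of_checkAt 19 0 1 0 (-177) 1171 (by norm_num)
      (by decide) (k := 1) (S := 0) (cert := []) (by decide +kernel) W' hW' h19).trans
      (by norm_num)

end Summit.BirchSwinnertonDyer.Rank1Residual.GaloisImage.DivisionDecider
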